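import Literature.Geometry.Riemannian.ConstantCurvatureRicci
import Literature.Geometry.Riemannian.HyperbolicBallCompactification
import Literature.Geometry.Riemannian.RoundSphere
import Literature.Geometry.Riemannian.RiemannianDistance
import Literature.Geometry.Lorentzian.Hypersurface
import Literature.Geometry.Lorentzian.IsometryProofs
import Literature.Topology.FourManifolds.ClosedBallTangent
import Literature.Topology.FourManifolds.ClosedBallSmoothEmbeddings
import Literature.Topology.FourManifolds.InteriorSmoothEmbedding
import Literature.Topology.FourManifolds.ImmersionCriterion
import Literature.Geometry.Manifold.OpenSubmanifoldMFDeriv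

/-!
# Crux `PEFillNearRound` (stmt-SmoothPoincare4-7997), line `Sketch`, helper piece `helper_rf_conformalInfinity` of
# `helper_roundFilled` (the round `S⁴` bounds hyperbolic `5`-space = route item
# `EinsteinBulk.RoundSphereBoundsHyperbolicSpace`, the base point of `stub_peFillStandard`)

Conformal infinity: the Euclidean metric of `𝔻⁵` restricts along the boundary inclusion `ι : 𝕊⁴ ↪ 𝔻⁵` to the round metric (conformal factor `φ ≡ 1`).
-/

noncomputable section

-- the prescribed namespace `Summit.<P>.<Sub>.…` duplicates `SmoothPoincare4` (P = Sub)
set_option linter.dupNamespace false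

open scoped Manifold ContDiff Topology RealInnerProductSpace
open Set Function Metric Bundle TopologicalSpace
open Literature.Geometry.Lorentzian Literature.Geometry.Lorentzian.PseudoRiemannianMetric
open Literature.Geometry.Riemannian Literature.Topology.FourManifolds
open Literature.Geometry.Manifold

namespace Summit.SmoothPoincare4.SmoothPoincare4.Cruxes.PEFillNearRound.RoundFilled

/-- The boundary inclusion `ι : 𝕊⁴ ↪ 𝔻⁵` is differentiable (it is a smooth embedding,
`isSmoothEmbedding_sphereInclusion'_holds`). [folklore] -/
private theorem mdifferentiableAt_sphereInclusion
    (y : ↥(Metric.sphere (0 : EuclideanSpace ℝ (Fin 5)) 1)) :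
    MDifferentiableAt (𝓡 4) (𝓡∂ 5)
      (Set.inclusion (Metric.sphere_subset_closedBall :
        (Metric.sphere (0 : EuclideanSpace ℝ (Fin 5)) 1) ⊆
          (Metric.closedBall (0 : EuclideanSpace ℝ (Fin 5)) 1))) y :=
  ((isSmoothEmbedding_sphereInclusion'_holds 4).contMDiff y).mdifferentiableAt (by simp)

/-- **Chain rule through the two inclusions**: `D_{ι y} (dι_y u) = d(val : 𝕊⁴ → ℝ⁵)_y u`, since
`val ∘ ι = val` and `D = d(val : 𝔻⁵ → ℝ⁵)` (`hasMFDerivAt_coe_closedBall`). [folklore] -/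
private theorem closedBallCoeDeriv_mfderiv_sphereInclusion
    (y : ↥(Metric.sphere (0 : EuclideanSpace ℝ (Fin 5)) 1)) (u : TangentSpace (𝓡 4) y) :
    closedBallCoeDeriv
        (Set.inclusion (Metric.sphere_subset_closedBall :
          (Metric.sphere (0 : EuclideanSpace ℝ (Fin 5)) 1) ⊆
            (Metric.closedBall (0 : EuclideanSpace ℝ (Fin 5)) 1)) y)
        (mfderiv (𝓡 4) (𝓡∂ 5)
          (Set.inclusion (Metric.sphere_subset_closedBall :
            (Metric.sphere (0 : EuclideanSpace ℝ (Fin 5)) 1) ⊆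
              (Metric.closedBall (0 : EuclideanSpace ℝ (Fin 5)) 1))) y u) =
      mfderiv (𝓡 4) 𝓘(ℝ, EuclideanSpace ℝ (Fin 5))
        (Subtype.val : ↥(Metric.sphere (0 : EuclideanSpace ℝ (Fin 5)) 1) →
          EuclideanSpace ℝ (Fin 5)) y u := by
  have h := ((hasMFDerivAt_coe_closedBall
    (Set.inclusion (Metric.sphere_subset_closedBall :
      (Metric.sphere (0 : EuclideanSpace ℝ (Fin 5)) 1) ⊆
        (Metric.closedBall (0 : EuclideanSpace ℝ (Fin 5)) 1)) y)).comp y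
    (mdifferentiableAt_sphereInclusion y).hasMFDerivAt).mfderiv
  have hval : ((Subtype.val : ↥(Metric.closedBall (0 : EuclideanSpace ℝ (Fin 5)) 1) →
        EuclideanSpace ℝ (Fin 5)) ∘
      Set.inclusion (Metric.sphere_subset_closedBall :
        (Metric.sphere (0 : EuclideanSpace ℝ (Fin 5)) 1) ⊆
          (Metric.closedBall (0 : EuclideanSpace ℝ (Fin 5)) 1))) =
      (Subtype.val : ↥(Metric.sphere (0 : EuclideanSpace ℝ (Fin 5)) 1) →
        EuclideanSpace ℝ (Fin 5)) :=
    funext fun _ => rfl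
  rw [hval] at h
  rw [h]
  rfl

/-- **`ι^*ḡ = g_round`** on the boundary `𝕊⁴` of the closed ball (O'Neill 1983, Ch. 3, Def. 3.4: the standard sphere as a Riemannian submanifold of `ℝⁿ⁺¹`). -/
theorem helper_rf_conformalInfinity :
    ∀ gb : Bundle.ContMDiffRiemannianMetric (𝓡∂ 5) 2 (EuclideanSpace ℝ (Fin 5)) (TangentSpace (𝓡∂ 5) : ↥(Metric.closedBall (0 : EuclideanSpace ℝ (Fin 5)) 1) → Type _), (∀ (p : ↥(Metric.closedBall (0 : EuclideanSpace ℝ (Fin 5)) 1)) (a b : TangentSpace (𝓡∂ 5) p), gb.inner p a b = inner ℝ (Literature.Topology.FourManifolds.closedBallCoeDeriv p a) (Literature.Topology.FourManifolds.closedBallCoeDeriv p b)) → ∀ (y : ↥(Metric.sphere (0 : EuclideanSpace ℝ (Fin 5)) 1)) (v w : TangentSpace (𝓡 4) y), gb.inner ((Set.inclusion (Metric.sphere_subset_closedBall : (Metric.sphere (0 : EuclideanSpace ℝ (Fin 5)) 1) ⊆ (Metric.closedBall (0 : EuclideanSpace ℝ (Fin 5)) 1))) y) (mfderiv (𝓡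 4) (𝓡∂ 5) (Set.inclusion (Metric.sphere_subset_closedBall : (Metric.sphere (0 : EuclideanSpace ℝ (Fin 5)) 1) ⊆ (Metric.closedBall (0 : EuclideanSpace ℝ (Fin 5)) 1))) y v) (mfderiv (𝓡 4) (𝓡∂ 5) (Set.inclusion (Metric.sphere_subset_closedBall : (Metric.sphere (0 : EuclideanSpace ℝ (Fin 5)) 1) ⊆ (Metric.closedBall (0 : EuclideanSpace ℝ (Fin 5)) 1))) y w) = ((@Literature.Geometry.Riemannian.roundMetric (EuclideanSpace ℝ (Fin 5)) _ _ 4 (Literature.Topology.FourManifolds.fact_finrank_euclideanSpace_succ 4)).toContMDiffRiemannianMetric (@Literature.Geometry.Riemannian.isRiemannian_roundMetric (EuclideanSpace ℝ (Fin 5)) _ _ 4 (Literature.Topology.FourManifolds.fact_finrank_euclideanSpace_succ 4))).inner y v w := by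
  intro gb hgb y v w
  rw [hgb, toContMDiffRiemannianMetric_inner,
    @roundMetric_apply (EuclideanSpace ℝ (Fin 5)) _ _ 4 (fact_finrank_euclideanSpace_succ 4),
    closedBallCoeDeriv_mfderiv_sphereInclusion, closedBallCoeDeriv_mfderiv_sphereInclusion]
  -- the two sides differ only in the (definitionally equal) sphere-instance paths: Mathlib's
  -- global instances vs. those under the `Fact` instance `fact_finrank_euclideanSpace_succ 4`
  rfl

end Summit.SmoothPoincare4.SmoothPoincare4.Cruxes.PEFillNearRound.RoundFilled

end
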